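import Summits.QuantumFields.QCD.Theorems.LightQuarkCompletion.Negative.Anatomy
import Summits.QuantumFields.QCD.Theorems.NestedDissectionSeaLightQuarkCompletionPhysicalBranchOfFrame

/-!
# Crux `LightQuarkCompletion` (stmt-QuantumFields-18066, route NestedDissectionSea, rank 6), line `Sketch` —
# the MASS-UNIT symmetry: the threshold `M₀` is `0` or `1` without loss (lead c5, cycle 5; `--supports`)

The renormalised mass tuples `m` of a `QCDRegularisation` are defined only up to the free constant of
`HasMassScaling` (`Z_m(k)/(log a_k⁻²)^{γ₀/2β₀} → c₀ > 0`, "the constant is the choice of mass unit", `QCDOS.lean`).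
The rescaling `Z_m ↦ Z_m / c` (`c > 0`, every other datum kept; written as an explicit structure term) realises the tuple `m` of the rescaled
regularisation as the tuple `c • m` of `reg` by the SAME lattice theories (`rescaleZm_scheme`: same `a, β, L`, same bare
trajectory), keeps both scalings, `m_crit`, chirality, and maps the crux's hypothesis package EXACTLY:
`HypAt Nf ⟨…, Z_m/c⟩ M₀ ↔ HypAt Nf reg (c * M₀)` (`hypAt_rescaleZm_iff`; pins: the probe depth `M ↦ cM` and the sea
tuple `m ↦ c • m` at unchanged physical radius `R`; body: `rfl`-level).  Consequences, kernel-checked: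

* `lightQuarkCompletion_iff_unitThreshold` (REGISTERED helper): the crux is EQUIVALENT to its two slices `M₀ = 0` and
  `M₀ = 1` — a positive threshold is unit freedom, not content; only the EXACT zero cone (`Concl`: zero-threshold pins, body at
  every positive tuple, chirality) is unit-free.  So the planner's child `ZeroThresholdDescent` may be filed at `M₀ = 1`.
* `zeroSlice_of_frame_of_jumpLineIsChiral`: the `M₀ = 0` slice closes from the frame (α) of item 17012 (`m_crit → 0`,
  landed `physicalBranch_of_frame`) and stub J of `Lines/Sketch.lean` (chirality of a zero-pinned body-carrying regularisation)
  with the witness `reg` ITSELF — no subsequence, no re-centring, no light-body continuation.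
* `lightQuarkCompletion_iff_zeroSlice_and_unitSlice`: the crux ↔ (zero slice ∧ unit slice); and since a package at `0` is a
  package at `1`, `lightQuarkCompletion_iff_unitSlice`: the crux ↔ its UNIT slice alone (WLOG `M₀ = 1`).

Complement to the standing disprover's TRANSLATION covariance (`upShift`, Negative `Anatomy`): this is the DILATION
covariance.  Pure bookkeeping over `QCDOS.lean` and the landed abbreviations `PinPkg`/`Body`/`HypAt`/`Concl`; no definition of
content, NO `def` and no notation (the rescaled regularisation is an explicit structure term; the slices are stated inline); standard axioms.
-/

noncomputable section

namespace Summit.QuantumFields.QCD.Theorems.LightQuarkJumpLine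

open MeasureTheory Filter Topology
open Literature.MathematicalPhysics.QuantumFieldTheory Literature.MathematicalPhysics.QuantumLattice
  Literature.Probability.LatticeModels
open Summit.QuantumFields.QCD.Theses.NestedDissectionSea (LightQuarkCompletion)
open Summit.QuantumFields.QCD.Theorems.CoerciveSeaNegative (PinClause)
open Summit.QuantumFields.QCD.Theorems.EarlyCrosserLawNegative (UpperPin)
open Summit.QuantumFields.QCD.Theorems.FrameAndSeparatorLawNegative (Frame)
open Summit.QuantumFields.QCD.Theorems.LightQuarkCompletion.Negative
  (PinPkg Body HypAt Concl lightQuarkCompletion_iff)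

variable {Nf : ℕ}

/-! ## §1 The mass-unit rescaling -/

/-! **The mass-unit rescaling** of a regularisation `reg : QCDRegularisation Nf` by `c > 0` is written EXPLICITLY below as
the structure term `QCDRegularisation.mk reg.a reg.a_pos reg.tendsto_a reg.β reg.L reg.tendsto_L reg.mcrit (fun k => reg.Zm k / c) _`
(`Z_m(k) ↦ Z_m(k) / c`, all other data kept; no definition and no notation is introduced) — so the tuple `m` of the rescaled
regularisation is realised by the bare trajectory of the tuple `c • m` of `reg`. -/

/-- The bare-mass algebra of the rescaling: `a x / (Z/c) = a (c x) / Z`. [folklore] -/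
theorem rescaleZm_offset (reg : QCDRegularisation Nf) {c : ℝ} (hc : 0 < c) (k : ℕ) (x : ℝ) :
    reg.a k * x / (reg.Zm k / c) = reg.a k * (c * x) / reg.Zm k := by
  have hZ : reg.Zm k ≠ 0 := (reg.Zm_pos k).ne'
  field_simp

/-- **The rescaled scheme at tuple `m` IS the original scheme at tuple `c • m`** (same lattice theories). [folklore] -/
theorem rescaleZm_scheme (reg : QCDRegularisation Nf) (c : ℝ) (hc : 0 < c) (m : Fin Nf → ℝ)
    (z shift : QCDField Nf → ℕ → ℝ) :
    (QCDRegularisation.mk reg.a reg.a_pos reg.tendsto_a reg.β reg.L reg.tendsto_L reg.mcrit (fun k => reg.Zm k / c) (fun k => div_pos (reg.Zm_pos k) hc) : QCDRegularisation Nf).scheme m z shift = reg.scheme (fun f => c * m f) z shift := by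
  simp only [QCDRegularisation.scheme, QCDScheme.mk.injEq, true_and, and_true]
  funext f k
  rw [rescaleZm_offset reg hc k (m f)]

/-- The rescaling keeps mass scaling (the constant becomes `c₀ / c`). [folklore] -/
theorem hasMassScaling_rescaleZm_iff (reg : QCDRegularisation Nf) (c : ℝ) (hc : 0 < c) :
    (QCDRegularisation.mk reg.a reg.a_pos reg.tendsto_a reg.β reg.L reg.tendsto_L reg.mcrit (fun k => reg.Zm k / c) (fun k => div_pos (reg.Zm_pos k) hc) : QCDRegularisation Nf).HasMassScaling ↔ reg.HasMassScaling := by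
  constructor
  · rintro ⟨c₀, hc₀, h⟩
    refine ⟨c₀ * c, mul_pos hc₀ hc, ?_⟩
    refine (h.mul_const c).congr fun k => ?_
    show reg.Zm k / c / Real.log (1 / reg.a k ^ 2) ^ massExponent Nf * c =
      reg.Zm k / Real.log (1 / reg.a k ^ 2) ^ massExponent Nf
    field_simp
  · rintro ⟨c₀, hc₀, h⟩
    refine ⟨c₀ / c, div_pos hc₀ hc, ?_⟩
    refine (h.div_const c).congr fun k => ?_
    show reg.Zm k / Real.log (1 / reg.a k ^ 2) ^ massExponent Nf / c =
      reg.Zm k / c / Real.log (1 / reg.a k ^ 2) ^ massExponent Nf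
    ring

/-- The rescaling keeps asymptotic scaling (which reads only `β, a`). [folklore] -/
theorem hasAsymptoticScaling_rescaleZm_iff (reg : QCDRegularisation Nf) (c : ℝ) (hc : 0 < c) :
    ((QCDRegularisation.mk reg.a reg.a_pos reg.tendsto_a reg.β reg.L reg.tendsto_L reg.mcrit (fun k => reg.Zm k / c) (fun k => div_pos (reg.Zm_pos k) hc) : QCDRegularisation Nf).scheme 0 0 0).HasAsymptoticScaling ↔ (reg.scheme 0 0 0).HasAsymptoticScaling := Iff.rfl

/-- The rescaling keeps chirality at zero (`m ↦ c • m` permutes the positive tuples). [folklore] -/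
theorem isChiralAtZero_rescaleZm_iff (reg : QCDRegularisation Nf) (c : ℝ) (hc : 0 < c) :
    (QCDRegularisation.mk reg.a reg.a_pos reg.tendsto_a reg.β reg.L reg.tendsto_L reg.mcrit (fun k => reg.Zm k / c) (fun k => div_pos (reg.Zm_pos k) hc) : QCDRegularisation Nf).IsChiralAtZero ↔ reg.IsChiralAtZero := by
  constructor
  · intro h ε hε
    obtain ⟨m, hm, hgap⟩ := h ε hε
    refine ⟨fun f => c * m f, fun f => mul_pos hc (hm f), ?_⟩
    rwa [rescaleZm_scheme reg c hc] at hgap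
  · intro h ε hε
    obtain ⟨m, hm, hgap⟩ := h ε hε
    refine ⟨fun f => m f / c, fun f => div_pos (hm f) hc, ?_⟩
    rw [rescaleZm_scheme reg c hc]
    have : (fun f => c * (m f / c)) = m := funext fun f => by field_simp
    rwa [this]

/-! ## §2 The pins and the body under the rescaling -/

/-- The lower pin of `reg` at depth threshold `c M₀` and sea tuple `c • m` is the lower pin of the rescaled regularisation at
`M₀` and `m` (same radius). [folklore] -/
theorem pinClause_rescaleZm {reg : QCDRegularisation Nf} {c : ℝ} (hc : 0 < c) {M₀ : ℝ} {m : Fin Nf → ℝ} {R : ℝ}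
    (h : PinClause Nf reg (c * M₀) (fun f => c * m f) R) : PinClause Nf (QCDRegularisation.mk reg.a reg.a_pos reg.tendsto_a reg.β reg.L reg.tendsto_L reg.mcrit (fun k => reg.Zm k / c) (fun k => div_pos (reg.Zm_pos k) hc) : QCDRegularisation Nf) M₀ m R := by
  intro M hM
  filter_upwards [h (c * M) (mul_lt_mul_of_pos_left hM hc)] with k hk S hS
  have hk' := hk S hS
  simp only [rescaleZm_offset reg hc] at hk' ⊢
  exact hk'

/-- Converse re-basing of the lower pin. [folklore] -/
theorem pinClause_of_rescaleZm {reg : QCDRegularisation Nf} {c : ℝ} (hc : 0 < c) {M₀ : ℝ} {m : Fin Nf → ℝ} {R : ℝ}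
    (h : PinClause Nf (QCDRegularisation.mk reg.a reg.a_pos reg.tendsto_a reg.β reg.L reg.tendsto_L reg.mcrit (fun k => reg.Zm k / c) (fun k => div_pos (reg.Zm_pos k) hc) : QCDRegularisation Nf) M₀ m R) : PinClause Nf reg (c * M₀) (fun f => c * m f) R := by
  intro M hM
  have hM' : M₀ < M / c := by rw [lt_div_iff₀ hc]; linarith
  filter_upwards [h (M / c) hM'] with k hk S hS
  have hk' := hk S hS
  have hcM : c * (M / c) = M := by field_simp
  simp only [rescaleZm_offset reg hc, hcM] at hk' ⊢
  exact hk'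

/-- The upper pin under the rescaling. [folklore] -/
theorem upperPin_rescaleZm {reg : QCDRegularisation Nf} {c : ℝ} (hc : 0 < c) {M₀ : ℝ} {m : Fin Nf → ℝ} {R : ℝ}
    (h : UpperPin Nf reg (c * M₀) (fun f => c * m f) R) : UpperPin Nf (QCDRegularisation.mk reg.a reg.a_pos reg.tendsto_a reg.β reg.L reg.tendsto_L reg.mcrit (fun k => reg.Zm k / c) (fun k => div_pos (reg.Zm_pos k) hc) : QCDRegularisation Nf) M₀ m R := by
  intro M hM
  filter_upwards [h (c * M) (mul_lt_mul_of_pos_left hM hc)] with k hk S hS hS2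
  have hk' := hk S hS hS2
  simp only [rescaleZm_offset reg hc] at hk' ⊢
  exact hk'

/-- Converse re-basing of the upper pin. [folklore] -/
theorem upperPin_of_rescaleZm {reg : QCDRegularisation Nf} {c : ℝ} (hc : 0 < c) {M₀ : ℝ} {m : Fin Nf → ℝ} {R : ℝ}
    (h : UpperPin Nf (QCDRegularisation.mk reg.a reg.a_pos reg.tendsto_a reg.β reg.L reg.tendsto_L reg.mcrit (fun k => reg.Zm k / c) (fun k => div_pos (reg.Zm_pos k) hc) : QCDRegularisation Nf) M₀ m R) : UpperPin Nf reg (c * M₀) (fun f => c * m f) R := by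
  intro M hM
  have hM' : M₀ < M / c := by rw [lt_div_iff₀ hc]; linarith
  filter_upwards [h (M / c) hM'] with k hk S hS hS2
  have hk' := hk S hS hS2
  have hcM : c * (M / c) = M := by field_simp
  simp only [rescaleZm_offset reg hc, hcM] at hk' ⊢
  exact hk'

/-- **The two-sided pin is dilation covariant**: pin above `M₀` for the rescaled regularisation ↔ pin above `c M₀` for
`reg`. [folklore] -/
theorem pinPkg_rescaleZm_iff (reg : QCDRegularisation Nf) {c : ℝ} (hc : 0 < c) (M₀ : ℝ) :
    PinPkg Nf (QCDRegularisation.mk reg.a reg.a_pos reg.tendsto_a reg.β reg.L reg.tendsto_L reg.mcrit (fun k => reg.Zm k / c) (fun k => div_pos (reg.Zm_pos k) hc) : QCDRegularisation Nf) M₀ ↔ PinPkg Nf reg (c * M₀) := by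
  constructor
  · intro h m hm
    have hm' : ∀ f, M₀ < m f / c := fun f => by rw [lt_div_iff₀ hc]; linarith [hm f]
    obtain ⟨R, hR, hlo, hup⟩ := h (fun f => m f / c) hm'
    have hcm : (fun f => c * (m f / c)) = m := funext fun f => by field_simp
    refine ⟨R, hR, ?_, ?_⟩
    · simpa only [hcm] using pinClause_of_rescaleZm hc hlo
    · simpa only [hcm] using upperPin_of_rescaleZm hc hup
  · intro h m hm
    obtain ⟨R, hR, hlo, hup⟩ := h (fun f => c * m f) fun f => mul_lt_mul_of_pos_left (hm f) hc
    exact ⟨R, hR, pinClause_rescaleZm hc hlo, upperPin_rescaleZm hc hup⟩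

/-- **The body is dilation covariant**: body above `M₀` for the rescaled regularisation ↔ body above `c M₀` for `reg`
(same lattice theories, same OS data). [folklore] -/
theorem body_rescaleZm_iff (reg : QCDRegularisation Nf) {c : ℝ} (hc : 0 < c) (M₀ : ℝ) :
    Body Nf (QCDRegularisation.mk reg.a reg.a_pos reg.tendsto_a reg.β reg.L reg.tendsto_L reg.mcrit (fun k => reg.Zm k / c) (fun k => div_pos (reg.Zm_pos k) hc) : QCDRegularisation Nf) M₀ ↔ Body Nf reg (c * M₀) := by
  constructor
  · intro h m hm
    have hm' : ∀ f, M₀ < m f / c := fun f => by rw [lt_div_iff₀ hc]; linarith [hm f]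
    obtain ⟨z, shift, T, hQ, hN, hG, hP, Δ, hΔ, hT, hL⟩ := h (fun f => m f / c) hm'
    have hcm : (fun f => c * (m f / c)) = m := funext fun f => by field_simp
    refine ⟨z, shift, T, ?_, hN, hG, hP, Δ, hΔ, hT, ?_⟩
    · rwa [rescaleZm_scheme reg c hc, hcm] at hQ
    · rwa [rescaleZm_scheme reg c hc, hcm] at hL
  · intro h m hm
    obtain ⟨z, shift, T, hQ, hN, hG, hP, Δ, hΔ, hT, hL⟩ :=
      h (fun f => c * m f) fun f => mul_lt_mul_of_pos_left (hm f) hc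
    refine ⟨z, shift, T, ?_, hN, hG, hP, Δ, hΔ, hT, ?_⟩
    · rwa [rescaleZm_scheme reg c hc]
    · rwa [rescaleZm_scheme reg c hc]

/-- **The whole hypothesis package is dilation covariant**: `HypAt` at `M₀` for the rescaled regularisation ↔ `HypAt` at
`c M₀` for `reg`. [folklore] -/
theorem hypAt_rescaleZm_iff (reg : QCDRegularisation Nf) {c : ℝ} (hc : 0 < c) (M₀ : ℝ) :
    HypAt Nf (QCDRegularisation.mk reg.a reg.a_pos reg.tendsto_a reg.β reg.L reg.tendsto_L reg.mcrit (fun k => reg.Zm k / c) (fun k => div_pos (reg.Zm_pos k) hc) : QCDRegularisation Nf) M₀ ↔ HypAt Nf reg (c * M₀) := by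
  constructor
  · rintro ⟨hMS, hAS, hbr, hM₀, hpin, hbody⟩
    exact ⟨(hasMassScaling_rescaleZm_iff reg c hc).1 hMS, (hasAsymptoticScaling_rescaleZm_iff reg c hc).1 hAS, hbr,
      (mul_nonneg_iff_of_pos_left hc).2 hM₀, (pinPkg_rescaleZm_iff reg hc M₀).1 hpin, (body_rescaleZm_iff reg hc M₀).1 hbody⟩
  · rintro ⟨hMS, hAS, hbr, hM₀, hpin, hbody⟩
    exact ⟨(hasMassScaling_rescaleZm_iff reg c hc).2 hMS, (hasAsymptoticScaling_rescaleZm_iff reg c hc).2 hAS, hbr,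
      (mul_nonneg_iff_of_pos_left hc).1 hM₀, (pinPkg_rescaleZm_iff reg hc M₀).2 hpin, (body_rescaleZm_iff reg hc M₀).2 hbody⟩

/-! ## §3 The crux is its zero slice and its unit slice -/

/-- **The crux is EQUIVALENT to its slices at `M₀ = 0` and `M₀ = 1`** (registered helper of line `Sketch`): a package at a positive threshold `M₀` is the package at threshold `1` of the mass-unit rescaling `Z_m ↦ Z_m/M₀` of `reg`, and the conclusion `Concl` does not mention the regularisation. -/
theorem lightQuarkCompletion_iff_unitThreshold : Summit.QuantumFields.QCD.Theses.NestedDissectionSea.LightQuarkCompletion ↔ ∀ Nf : ℕ, (Nf = 2 ∨ Nf = 3) → ∀ reg : QCDRegularisation Nf, (HypAt Nf reg 0 ∨ HypAt Nf reg 1) → Concl Nf := by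
  rw [lightQuarkCompletion_iff]
  constructor
  · rintro h Nf hNf reg (hH | hH)
    · exact h Nf hNf reg 0 hH
    · exact h Nf hNf reg 1 hH
  · intro h Nf hNf reg M₀ hH
    rcases eq_or_lt_of_le hH.2.2.2.1 with hM₀ | hM₀
    · exact h Nf hNf reg (Or.inl (hM₀ ▸ hH))
    · refine h Nf hNf (QCDRegularisation.mk reg.a reg.a_pos reg.tendsto_a reg.β reg.L reg.tendsto_L reg.mcrit (fun k => reg.Zm k / M₀) (fun k => div_pos (reg.Zm_pos k) hM₀) : QCDRegularisation Nf) (Or.inr ?_)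
      rw [hypAt_rescaleZm_iff reg hM₀ 1, mul_one]
      exact hH

/-- **The crux ↔ (its `M₀ = 0` slice) ∧ (its `M₀ = 1` slice)**: every regularisation carrying the package at ZERO
threshold yields `Concl`, and every regularisation carrying it at UNIT threshold yields `Concl`. [folklore] -/
theorem lightQuarkCompletion_iff_zeroSlice_and_unitSlice :
    Summit.QuantumFields.QCD.Theses.NestedDissectionSea.LightQuarkCompletion ↔
      (∀ Nf : ℕ, (Nf = 2 ∨ Nf = 3) → ∀ reg : QCDRegularisation Nf, HypAt Nf reg 0 → Concl Nf) ∧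
      (∀ Nf : ℕ, (Nf = 2 ∨ Nf = 3) → ∀ reg : QCDRegularisation Nf, HypAt Nf reg 1 → Concl Nf) := by
  rw [lightQuarkCompletion_iff_unitThreshold]
  constructor
  · intro h
    exact ⟨fun Nf hNf reg hH => h Nf hNf reg (Or.inl hH), fun Nf hNf reg hH => h Nf hNf reg (Or.inr hH)⟩
  · rintro ⟨h0, h1⟩ Nf hNf reg (hH | hH)
    · exact h0 Nf hNf reg hH
    · exact h1 Nf hNf reg hH

/-- **The zero slice closes from the frame (α) and stub J, with the witness `reg` itself.**  Given the package at zero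
threshold, (α) (item 17012, through the landed `physicalBranch_of_frame`) gives `m_crit → 0`, and J (chirality of a zero-pinned,
body-carrying, asymptotically free, mass-scaling regularisation with `m_crit → 0`) gives `IsChiralAtZero`; the pins and the body at
zero threshold are the hypothesis.  So ALL the light-quark content of the crux beyond (α) + J sits in the unit slice. [folklore] -/
theorem zeroSlice_of_frame_of_jumpLineIsChiral (hF : Frame)
    (hJ : ∀ Nf : ℕ, (Nf = 2 ∨ Nf = 3) → ∀ reg' : QCDRegularisation Nf,
      reg'.HasMassScaling → (reg'.scheme 0 0 0).HasAsymptoticScaling → Tendsto reg'.mcrit atTop (𝓝 0) →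
      (∀ m : Fin Nf → ℝ, (∀ f, 0 < m f) → ∃ R : ℝ, 0 < R ∧ PinClause Nf reg' 0 m R ∧ UpperPin Nf reg' 0 m R) →
      (∀ m : Fin Nf → ℝ, (∀ f, 0 < m f) → ∃ (z shift : QCDField Nf → ℕ → ℝ) (T : OSData (QCDField Nf) 4),
        IsQCDAlong (reg'.scheme m z shift) T ∧ T.IsNontrivial QCDField.glue ∧ T.IsNonGaussian QCDField.glue ∧
          (∀ f g : Fin Nf, f ≠ g → T.IsNontrivial (QCDField.pseudoRe f g)) ∧
            ∃ Δ > 0, T.HasMassGap Δ ∧ (reg'.scheme m z shift).HasLatticeMassGap Δ) →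
      reg'.IsChiralAtZero) :
    ∀ Nf : ℕ, (Nf = 2 ∨ Nf = 3) → ∀ reg : QCDRegularisation Nf, HypAt Nf reg 0 → Concl Nf := by
  rintro Nf hNf reg ⟨hMS, hAS, -, -, hpin, hbody⟩
  have hlim : Tendsto reg.mcrit atTop (𝓝 0) := physicalBranch_of_frame hF Nf hNf reg hMS hAS 0 le_rfl hpin
  exact ⟨reg, hMS, hAS, hlim, hpin, hJ Nf hNf reg hMS hAS hlim hpin hbody, hbody⟩

/-- **WLOG `M₀ = 1`: the crux IS its unit slice.**  A package at ZERO threshold is a package at threshold `1`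
(`pinPkg_mono`, `body_mono`), so the `M₀ = 0` slice follows from the `M₀ = 1` slice, and by
`lightQuarkCompletion_iff_unitThreshold` the crux is EQUIVALENT to "every regularisation carrying the package at UNIT
threshold yields `Concl`".  Reading for the planner: the child `ZeroThresholdDescent` may be filed with `M₀ := 1` and no
`∀ M₀ ≥ 0` binder; the zero slice (`zeroSlice_of_frame_of_jumpLineIsChiral`: (α) + J) is where the crux is ALREADY reduced to
existing typings. [folklore] -/
theorem lightQuarkCompletion_iff_unitSlice :
    Summit.QuantumFields.QCD.Theses.NestedDissectionSea.LightQuarkCompletion ↔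
      ∀ Nf : ℕ, (Nf = 2 ∨ Nf = 3) → ∀ reg : QCDRegularisation Nf, HypAt Nf reg 1 → Concl Nf := by
  rw [lightQuarkCompletion_iff_zeroSlice_and_unitSlice]
  constructor
  · exact fun h => h.2
  · intro h
    refine ⟨fun Nf hNf reg hH => h Nf hNf reg ?_, h⟩
    obtain ⟨hMS, hAS, hbr, -, hpin, hbody⟩ := hH
    exact ⟨hMS, hAS, hbr, zero_le_one,
      Summit.QuantumFields.QCD.Theorems.LightQuarkCompletion.Negative.pinPkg_mono hpin zero_le_one,
      Summit.QuantumFields.QCD.Theorems.LightQuarkCompletion.Negative.body_mono hbody zero_le_one⟩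

end Summit.QuantumFields.QCD.Theorems.LightQuarkJumpLine

end
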